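/-
Copyright (c) 2026 the pub-hodgecm-mathlib formalisation cell (harness21).  Prover seat hodgecm-mathlib-K2E3-p03 (g8), HCML Track B «K2-LIT» ∕ h413
(`stmt-HodgeConjecture-24833`), leaf (nsc-S-A′), bricks C1′ NAA and C1″ NYA (D131): «NO `A` ALONE» AND «NO `Y` ALONE», UNCONDITIONALLY.  2026-09-04.
-/
import Summits.HodgeConjecture.HodgeConjecture.Theorems.K2E3GL3NoWeightAAloneEmbedding        -- (this seat) `exists_injective_intertwiningMap_D_low`
import Summits.HodgeConjecture.HodgeConjecture.Theorems.K2E3GL3NoWeightAloneTransport         -- ★ (T) (this seat): `forall_noWeightYAlone_of_forall_noWeightAAlone`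
import Summits.HodgeConjecture.HodgeConjecture.Theorems.K2E3GL3OneLinkNestedHighIrreduciblePrime  -- ★ F5 (this seat): `isIrreducible_D_low_of_isIrreducible_D_high`
import Summits.HodgeConjecture.HodgeConjecture.Theorems.K2E3GL3OneLinkNestedHighIrreducible   -- ★ IRR″ HEAD (K2E3-p17 g9): `isIrreducible_D_high`, `surjective_twoOne`; brings ★ `monotone_twoOne`
import Summits.HodgeConjecture.HodgeConjecture.Theorems.K2E3GL3OneLinkNestedLowPieces         -- ★ C1′ L1 (K2E3-p25 g3): `finrank_weightSpace_D_low`, `tch_B_ne_A`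
import Summits.HodgeConjecture.HodgeConjecture.Theorems.K2E3GL3PrincipalSeriesThreeCell      -- ★ (CELL-3) (this lineage, g7): `principalSeriesThreeCell`
import HarnessLib

/-!
# Crux `H413` — leaf (nsc-S-A′), bricks C1′∕C1″: «NO `A` ALONE» (NAA) and «NO `Y` ALONE» (NYA) — unconditional

Cell `hodgecm-mathlib`, Track B; THEOREMS ONLY; count-neutral helper (`--supports stmt-HodgeConjecture-24833 --as helper`).  Letters `a = ην½⁻¹`, `aν = ην½`,
`A = tch(a,aν,a)`, `B = tch(a,a,aν)`, `Y = tch(aν,a,aν)`; `D♭(η) = D(η, ην½⁻¹) = parabolicIndGL F ![f,f,t] (𝟙.twist ψ_Q(η, ην½⁻¹))` with `E(D♭) = {B², A}` (★ C1′ L1).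
* §1 **`false_of_weight_A_one`** — an irreducible `ω` with `E(ω) = {A¹}` (subquotient of a smooth `I` with the cell hypothesis) cannot exist once `D♭(η)` is irreducible: the Frobenius
  embedding `ω ↪ D♭(η)` (`exists_injective_intertwiningMap_D_low`) is onto (`D♭` irreducible), so `mult ω B = mult D♭ B = 2 ≠ 0` (★ L1 `finrank_weightSpace_D_low`) ✗.
* §2 **`noWeightAAlone_of_isIrreducible_D_low (η) (hη) (hIRR♭)`** — NAA(η) in the `hNYA`-binder currency of ★ p861011 (`∀ r admissible [fd r_B], mult r A = 1 → (∀ ζ ≠ A, mult r ζ = 0) →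
  False`): present `r ↪ I(A)` by ★ EMB, the cell hypothesis by ★ (CELL-3) `principalSeriesThreeCell` at `c = ![0,0,1]`.
* §3 UNCONDITIONAL FORMS (`[CharZero F]`, the (CELL-3) currency): **`noWeightAAlone`** `: ∀ η, IsOpen ker η → NAA(η)` — `D♭(η)` irreducible by ★ F5
  `isIrreducible_D_low_of_isIrreducible_D_high` over ★ IRR″ HEAD `isIrreducible_D_high` (K2E3-p17 (g9)) at `η⁻¹`; **`noWeightYAlone`** `: ∀ η, IsOpen ker η → NYA(η)` by ★ (T)
  `forall_noWeightYAlone_of_forall_noWeightAAlone` — the conclusion is the (C1″-NYA) socket `sig_K2E3GL3NestedHighNoWeightYAlone` body per `F` (tie: `fun F _ _ _ _ _ => noWeightYAlone`),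
  and `noWeightAAlone` is the (C1′-NAA) letter of K2E3-p25 (g3)'s ★ `K2E3GL3OneLinkNestedLow.sAprimeC1low_of`.
[BernsteinZelevinsky1977, Prop. 1.9, §2.3, Cor. 2.13, Thm. 2.5, Thm. 2.9]; [Zelevinsky1980, §1.6, Prop. 2.10, Ex. 3.2, Thm. 4.2, Thm. 6.1].

HONEST LABEL: HC_CM is proved only modulo the 7 printed citations (2 remaining named inputs: hLiu418 = stmt-HodgeConjecture-24832, h413 =
stmt-HodgeConjecture-24833) until rung 0 closes; count-neutral helper; NAA∕NYA here are UNCONDITIONAL theorems (no named hypothesis).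

## References
* [BernsteinZelevinsky1977] I. N. Bernstein, A. V. Zelevinsky, *Induced representations of reductive p-adic groups I*, Ann. Sci. ÉNS 10 (1977), Prop. 1.9, §2.3, Cor. 2.13, Thm. 2.5, Thm. 2.9.
* [Zelevinsky1980] A. V. Zelevinsky, *Induced representations of reductive p-adic groups II*, Ann. Sci. ÉNS 13 (1980), §1.6, Prop. 2.10, Ex. 3.2, Thm. 4.2, Thm. 6.1.
-/

set_option autoImplicit false
-- the mandated namespace repeats `HodgeConjecture.HodgeConjecture`, as in every `Theorems/*.lean` of this sub-problem
set_option linter.dupNamespace false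

noncomputable section

open Module Module.End Representation Function Literature.NumberTheory.Automorphic Literature.NumberTheory.Automorphic.Zelevinsky1980
open Literature.NumberTheory.GaloisRepresentations.IsNonarchimedeanLocalField Literature.RepresentationTheory.FiniteGroups
open scoped MatrixGroups NNReal
open Summit.HodgeConjecture.HodgeConjecture.Cruxes.H413.K2E3GL3NoWeightAAloneEmbedding (exists_injective_intertwiningMap_D_low)
open Summit.HodgeConjecture.HodgeConjecture.Cruxes.H413.K2E3GL3NoWeightAloneTransport (forall_noWeightYAlone_of_forall_noWeightAAlone)
open Summit.HodgeConjecture.HodgeConjecture.Cruxes.H413.K2E3GL3OneLinkNestedHighIrreduciblePrime (isIrreducible_D_low_of_isIrreducible_D_high)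
open Summit.HodgeConjecture.HodgeConjecture.Cruxes.H413.K2E3GL3OneLinkNestedHighIrreducible (isIrreducible_D_high surjective_twoOne)
open Summit.HodgeConjecture.HodgeConjecture.Cruxes.H413.K2E3GL3MaximalParabolicRelabel (monotone_twoOne)
open Summit.HodgeConjecture.HodgeConjecture.Cruxes.H413.K2E3GL3OneLinkNestedLowPieces (finrank_weightSpace_D_low tch_B_ne_A)
open Summit.HodgeConjecture.HodgeConjecture.Cruxes.H413.K2E3GL3PrincipalSeriesThreeCell (principalSeriesThreeCell)
open Summit.HodgeConjecture.HodgeConjecture.Cruxes.H413.K2E3GL3EmbeddingOfWeight (exists_injective_intertwiningMap_parabolicIndGL)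
open Summit.HodgeConjecture.HodgeConjecture.Cruxes.H413.K2E3GL3ExponentClassTools (nonempty_equiv_range)
open Summit.HodgeConjecture.HodgeConjecture.Cruxes.H413.K2E3GL3JacquetMultiplicityAdditive (finrank_weightSpace_eq_of_equiv)
open Summit.HodgeConjecture.HodgeConjecture.Cruxes.H413.K2E3GL3StandardModuleEmbedding (ker_inv_eq_ker)
open Summit.HodgeConjecture.HodgeConjecture.Cruxes.H413

namespace Summit.HodgeConjecture.HodgeConjecture.Cruxes.H413.K2E3GL3NoWeightAlone

variable {F : Type} [Field F] [ValuativeRel F] [TopologicalSpace F] [IsNonarchimedeanLocalField F] (η : Fˣ →* ℂˣ)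

/-! ## §1 No irreducible `{A¹}`-constituent once `D♭` is irreducible -/

set_option maxHeartbeats 1600000 in  -- cumulative budget over large weight terms
/-- **NO IRREDUCIBLE `ω` WITH `E(ω) = {A¹}`** (given `D♭(η)` irreducible; `ω` a subquotient of a smooth `I` with the cell hypothesis): the injective `Φ : ω → D♭(η)`
(`exists_injective_intertwiningMap_D_low`) is onto, so `ω ≅ D♭(η)` and `mult ω B = mult D♭ B = 2` (★ C1′ L1) against `mult ω B = 0`.
[cite: BernsteinZelevinsky1977, Thm. 2.5, Cor. 2.13, Thm. 2.9] [cite: Zelevinsky1980, Ex. 3.2, Thm. 6.1] -/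
theorem false_of_weight_A_one (hη : IsOpen ((η.ker : Subgroup Fˣ) : Set Fˣ)) (hIRR : ((Representation.parabolicIndGL F (![false, false, true] : Fin 3 → Bool) ((Representation.trivial ℂ (Π a : Bool, GL {i : Fin 3 // (![false, false, true] : Fin 3 → Bool) i = a} F) ℂ).twist ((η.comp (Matrix.GeneralLinearGroup.det.comp (Pi.evalMonoidHom (fun a : Bool => GL {i : Fin 3 // (![false, false, true] : Fin 3 → Bool) i = a} F) false))) * ((η * ((unramifiedTwist F (1 / 2) : QuasiChar F).toMonoidHom)⁻¹).comp (Matrix.GeneralLinearGroup.det.comp (Pi.evalMonoidHom (fun a : Bool => GL {i : Fin 3 // (![false, false, true] : Fin 3 → Bool) i = a} F) true))))))).IsIrreducible)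
    {XI X₁ X : Type} [AddCommGroup XI] [Module ℂ XI] [AddCommGroup X₁] [Module ℂ X₁] [AddCommGroup X] [Module ℂ X]
    (I : Representation ℂ (GL (Fin 3) F) XI) (ω₁ : Representation ℂ (GL (Fin 3) F) X₁) (ω : Representation ℂ (GL (Fin 3) F) X) (hI : I.IsSmooth)
    (hcell : ∀ (W : Type) [AddCommGroup W] [Module ℂ W] (σ : Representation ℂ (Π a, GL {i // (![0, 0, 1] : Fin 3 → Fin 2) i = a} F) W),
      σ.IsIrreducible → σ.IsSmooth → σ.IsSupercuspidal → ∀ (N : Subrepresentation (jacquetGL F (![0, 0, 1] : Fin 3 → Fin 2) I)) (q : N.toRepresentation.IntertwiningMap σ), q = 0)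
    (ι₁ : ω₁.IntertwiningMap I) (hι₁ : Function.Injective ι₁) (π₁ : ω₁.IntertwiningMap ω) (hπ₁ : Function.Surjective π₁) [ω.IsIrreducible] (hω : ω.IsSmooth)
    [FiniteDimensional ℂ (Representation.restrictUnipotentGL F (id : Fin 3 → Fin 3) ω).Coinvariants]
    (hA : finrank ℂ ↥(⨅ m, Module.End.maxGenEigenspace (Representation.normalizedJacquetGL F (id : Fin 3 → Fin 3) ω m) (((∏ a : Fin 3, ((![(η * ((unramifiedTwist F (1 / 2) : QuasiChar F).toMonoidHom)⁻¹), (η * ((unramifiedTwist F (1 / 2) : QuasiChar F).toMonoidHom)), (η * ((unramifiedTwist F (1 / 2) : QuasiChar F).toMonoidHom)⁻¹)] : Fin 3 → (Fˣ →* ℂˣ)) a).comp (Matrix.GeneralLinearGroup.det.comp (Pi.evalMonoidHom (fun a : Fin 3 => GL {i : Fin 3 // (id : Fin 3 → Fin 3) i = a} F) a))) m : ℂˣ) : ℂ)) = 1)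
    (h0 : ∀ ζ : (Π a : Fin 3, GL {i : Fin 3 // (id : Fin 3 → Fin 3) i = a} F) → ℂ, ζ ≠ (fun m : (Π a : Fin 3, GL {i : Fin 3 // (id : Fin 3 → Fin 3) i = a} F) => (((∏ a : Fin 3, ((![(η * ((unramifiedTwist F (1 / 2) : QuasiChar F).toMonoidHom)⁻¹), (η * ((unramifiedTwist F (1 / 2) : QuasiChar F).toMonoidHom)), (η * ((unramifiedTwist F (1 / 2) : QuasiChar F).toMonoidHom)⁻¹)] : Fin 3 → (Fˣ →* ℂˣ)) a).comp (Matrix.GeneralLinearGroup.det.comp (Pi.evalMonoidHom (fun a : Fin 3 => GL {i : Fin 3 // (id : Fin 3 → Fin 3) i = a} F) a))) m : ℂˣ) : ℂ)) → finrank ℂ ↥(⨅ m, Module.End.maxGenEigenspace (Representation.normalizedJacquetGL F (id : Fin 3 → Fin 3) ω m) (ζ m)) = 0) : False := by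
  haveI : IsTopologicalRing F := inferInstance
  have hΦex := exists_injective_intertwiningMap_D_low η hη I ω₁ ω hI hcell ι₁ hι₁ π₁ hπ₁ hω hA h0
  obtain ⟨Φ, hΦ⟩ := hΦex
  haveI := hIRR
  haveI : Nontrivial X := Representation.IsIrreducible.nontrivial ω
  have hne : Φ.range ≠ ⊥ := by
    intro hbot
    obtain ⟨v, hv⟩ := exists_ne (0 : X)
    have hmem : Φ v ∈ Φ.range := ⟨v, rfl⟩
    rw [hbot] at hmem
    exact hv (hΦ (((Submodule.mem_bot ℂ).1 hmem).trans (map_zero Φ).symm))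
  have htop : Φ.range = ⊤ := (eq_bot_or_eq_top Φ.range).resolve_left hne
  have her := nonempty_equiv_range Φ hΦ
  obtain ⟨er⟩ := her
  have etop : Φ.range.toRepresentation.Equiv (Representation.parabolicIndGL F (![false, false, true] : Fin 3 → Bool) ((Representation.trivial ℂ (Π a : Bool, GL {i : Fin 3 // (![false, false, true] : Fin 3 → Bool) i = a} F) ℂ).twist ((η.comp (Matrix.GeneralLinearGroup.det.comp (Pi.evalMonoidHom (fun a : Bool => GL {i : Fin 3 // (![false, false, true] : Fin 3 → Bool) i = a} F) false))) * ((η * ((unramifiedTwist F (1 / 2) : QuasiChar F).toMonoidHom)⁻¹).comp (Matrix.GeneralLinearGroup.det.comp (Pi.evalMonoidHom (fun a : Bool => GL {i : Fin 3 // (![false, false, true] : Fin 3 → Bool) i = a} F) true)))))) :=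
    Representation.Equiv.mk (LinearEquiv.ofTop Φ.range.toSubmodule (by rw [htop]; rfl)) fun g => LinearMap.ext fun _ => rfl
  have e := er.trans etop
  have hB := (finrank_weightSpace_D_low η hη (fun m : (Π a : Fin 3, GL {i : Fin 3 // (id : Fin 3 → Fin 3) i = a} F) => (((∏ a : Fin 3, ((![(η * ((unramifiedTwist F (1 / 2) : QuasiChar F).toMonoidHom)⁻¹), (η * ((unramifiedTwist F (1 / 2) : QuasiChar F).toMonoidHom)⁻¹), (η * ((unramifiedTwist F (1 / 2) : QuasiChar F).toMonoidHom))] : Fin 3 → (Fˣ →* ℂˣ)) a).comp (Matrix.GeneralLinearGroup.det.comp (Pi.evalMonoidHom (fun a : Fin 3 => GL {i : Fin 3 // (id : Fin 3 → Fin 3) i = a} F) a))) m : ℂˣ) : ℂ))).2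
  beta_reduce at hB
  rw [if_pos rfl, if_neg (tch_B_ne_A η), ← finrank_weightSpace_eq_of_equiv _ _ e (fun m : (Π a : Fin 3, GL {i : Fin 3 // (id : Fin 3 → Fin 3) i = a} F) => (((∏ a : Fin 3, ((![(η * ((unramifiedTwist F (1 / 2) : QuasiChar F).toMonoidHom)⁻¹), (η * ((unramifiedTwist F (1 / 2) : QuasiChar F).toMonoidHom)⁻¹), (η * ((unramifiedTwist F (1 / 2) : QuasiChar F).toMonoidHom))] : Fin 3 → (Fˣ →* ℂˣ)) a).comp (Matrix.GeneralLinearGroup.det.comp (Pi.evalMonoidHom (fun a : Fin 3 => GL {i : Fin 3 // (id : Fin 3 → Fin 3) i = a} F) a))) m : ℂˣ) : ℂ))] at hB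
  have h0B := h0 (fun m : (Π a : Fin 3, GL {i : Fin 3 // (id : Fin 3 → Fin 3) i = a} F) => (((∏ a : Fin 3, ((![(η * ((unramifiedTwist F (1 / 2) : QuasiChar F).toMonoidHom)⁻¹), (η * ((unramifiedTwist F (1 / 2) : QuasiChar F).toMonoidHom)⁻¹), (η * ((unramifiedTwist F (1 / 2) : QuasiChar F).toMonoidHom))] : Fin 3 → (Fˣ →* ℂˣ)) a).comp (Matrix.GeneralLinearGroup.det.comp (Pi.evalMonoidHom (fun a : Fin 3 => GL {i : Fin 3 // (id : Fin 3 → Fin 3) i = a} F) a))) m : ℂˣ) : ℂ)) (tch_B_ne_A η)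
  beta_reduce at h0B
  omega

/-! ## §2 NAA(η) from the irreducibility of `D♭(η)` -/

/-- **NAA(η) ⟸ `D♭(η)` irreducible** (`[CharZero F]` for the (CELL-3) currency): an admissible irreducible `r` with `E(r) = {A¹}` embeds in `I(A)` (★ EMB), the cell hypothesis at
`c = ![0,0,1]` is ★ (CELL-3) `principalSeriesThreeCell`, and §1 applies with `ω = r`, `π₁ = id`. [cite: BernsteinZelevinsky1977, Thm. 2.5, Thm. 2.9] [cite: Zelevinsky1980, Ex. 3.2, Thm. 6.1] -/
theorem noWeightAAlone_of_isIrreducible_D_low [CharZero F] (hη : IsOpen ((η.ker : Subgroup Fˣ) : Set Fˣ)) (hIRR : ((Representation.parabolicIndGL F (![false, false, true] : Fin 3 → Bool) ((Representation.trivial ℂ (Π a : Bool, GL {i : Fin 3 // (![false, false, true] : Fin 3 → Bool) i = a} F) ℂ).twist ((η.comp (Matrix.GeneralLinearGroup.det.comp (Pi.evalMonoidHom (fun a : Bool => GL {i : Fin 3 // (![false, false, true] : Fin 3 → Bool) i = a} F) false))) * ((η * ((unramifiedTwist F (1 / 2) : QuasiChar F).toMonoidHom)⁻¹).comp (Matrix.GeneralLinearGroup.det.comp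 (Pi.evalMonoidHom (fun a : Bool => GL {i : Fin 3 // (![false, false, true] : Fin 3 → Bool) i = a} F) true))))))).IsIrreducible) :
    ∀ (r : SmoothIrrep (GL (Fin 3) F)), r.ρ.IsAdmissible → ∀ [FiniteDimensional ℂ (restrictUnipotentGL F (id : Fin 3 → Fin 3) r.ρ).Coinvariants],
      finrank ℂ ↥(⨅ m, Module.End.maxGenEigenspace (Representation.normalizedJacquetGL F (id : Fin 3 → Fin 3) r.ρ m) (((∏ a : Fin 3, ((![(η * ((unramifiedTwist F (1 / 2) : QuasiChar F).toMonoidHom)⁻¹), (η * ((unramifiedTwist F (1 / 2) : QuasiChar F).toMonoidHom)), (η * ((unramifiedTwist F (1 / 2) : QuasiChar F).toMonoidHom)⁻¹)] : Fin 3 → (Fˣ →* ℂˣ)) a).comp (Matrix.GeneralLinearGroup.det.comp (Pi.evalMonoidHom (fun a : Fin 3 => GL {i : Fin 3 // (id : Fin 3 → Fin 3) i = a} F) a))) m : ℂˣ) : ℂ)) = 1 →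
      (∀ ζ : (Π a : Fin 3, GL {i : Fin 3 // (id : Fin 3 → Fin 3) i = a} F) → ℂ, ζ ≠ (fun m : (Π a : Fin 3, GL {i : Fin 3 // (id : Fin 3 → Fin 3) i = a} F) => (((∏ a : Fin 3, ((![(η * ((unramifiedTwist F (1 / 2) : QuasiChar F).toMonoidHom)⁻¹), (η * ((unramifiedTwist F (1 / 2) : QuasiChar F).toMonoidHom)), (η * ((unramifiedTwist F (1 / 2) : QuasiChar F).toMonoidHom)⁻¹)] : Fin 3 → (Fˣ →* ℂˣ)) a).comp (Matrix.GeneralLinearGroup.det.comp (Pi.evalMonoidHom (fun a : Fin 3 => GL {i : Fin 3 // (id : Fin 3 → Fin 3) i = a} F) a))) m : ℂˣ) : ℂ)) → finrank ℂ ↥(⨅ m, Module.End.maxGenEigenspace (Representation.normalizedJacquetGL F (id : Fin 3 → Fin 3) r.ρ m) (ζ m)) = 0) → False := by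
  intro r hadm hfd h1 h0
  haveI : r.ρ.IsIrreducible := r.isIrreducible
  have hι := exists_injective_intertwiningMap_parabolicIndGL r.ρ r.isSmooth (∏ a : Fin 3, ((![(η * ((unramifiedTwist F (1 / 2) : QuasiChar F).toMonoidHom)⁻¹), (η * ((unramifiedTwist F (1 / 2) : QuasiChar F).toMonoidHom)), (η * ((unramifiedTwist F (1 / 2) : QuasiChar F).toMonoidHom)⁻¹)] : Fin 3 → (Fˣ →* ℂˣ)) a).comp (Matrix.GeneralLinearGroup.det.comp (Pi.evalMonoidHom (fun a : Fin 3 => GL {i : Fin 3 // (id : Fin 3 → Fin 3) i = a} F) a))) (by rw [h1]; exact one_ne_zero)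
  obtain ⟨ι₁, hι₁⟩ := hι
  exact false_of_weight_A_one η hη hIRR (Representation.parabolicIndGL F (id : Fin 3 → Fin 3) ((Representation.trivial ℂ (Π a : Fin 3, GL {i : Fin 3 // (id : Fin 3 → Fin 3) i = a} F) ℂ).twist (∏ a : Fin 3, ((![(η * ((unramifiedTwist F (1 / 2) : QuasiChar F).toMonoidHom)⁻¹), (η * ((unramifiedTwist F (1 / 2) : QuasiChar F).toMonoidHom)), (η * ((unramifiedTwist F (1 / 2) : QuasiChar F).toMonoidHom)⁻¹)] : Fin 3 → (Fˣ →* ℂˣ)) a).comp (Matrix.GeneralLinearGroup.det.comp (Pi.evalMonoidHom (fun a : Fin 3 => GL {i : Fin 3 // (id : Fin 3 → Fin 3) i = a} F) a))))) r.ρ r.ρ (Representation.isSmooth_smoothInd _ _)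
    (principalSeriesThreeCell F (∏ a : Fin 3, ((![(η * ((unramifiedTwist F (1 / 2) : QuasiChar F).toMonoidHom)⁻¹), (η * ((unramifiedTwist F (1 / 2) : QuasiChar F).toMonoidHom)), (η * ((unramifiedTwist F (1 / 2) : QuasiChar F).toMonoidHom)⁻¹)] : Fin 3 → (Fˣ →* ℂˣ)) a).comp (Matrix.GeneralLinearGroup.det.comp (Pi.evalMonoidHom (fun a : Fin 3 => GL {i : Fin 3 // (id : Fin 3 → Fin 3) i = a} F) a))) (![0, 0, 1] : Fin 3 → Fin 2) monotone_twoOne surjective_twoOne)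
    ι₁ hι₁ (Representation.IntertwiningMap.id r.ρ) (fun v => ⟨v, rfl⟩) r.isSmooth h1 h0

/-! ## §3 Unconditional NAA and NYA -/

/-- **NAA — «NO `A` ALONE», UNCONDITIONALLY**: for every `η` with open kernel, no admissible irreducible `r` of `GL₃(F)` has `E(r) = {A(η)¹}`, `A(η) = tch(ην½⁻¹, ην½, ην½⁻¹)`.
`D♭(η)` is irreducible by ★ F5 over ★ IRR″ HEAD `isIrreducible_D_high` at `η⁻¹` (its cell binder for `I(X(η⁻¹))` and F5's for `I(Y(η⁻¹))` are ★ (CELL-3)).  This is the (C1′-NAA) letter of ★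
`K2E3GL3OneLinkNestedLow.sAprimeC1low_of`. [cite: Zelevinsky1980, Thm. 4.2, Ex. 3.2, Thm. 6.1] [cite: BernsteinZelevinsky1977, Thm. 2.5, Thm. 2.9] -/
theorem noWeightAAlone [CharZero F] : ∀ η : Fˣ →* ℂˣ, IsOpen ((η.ker : Subgroup Fˣ) : Set Fˣ) → ∀ (r : SmoothIrrep (GL (Fin 3) F)), r.ρ.IsAdmissible → ∀ [FiniteDimensional ℂ (restrictUnipotentGL F (id : Fin 3 → Fin 3) r.ρ).Coinvariants],
      finrank ℂ ↥(⨅ m, Module.End.maxGenEigenspace (Representation.normalizedJacquetGL F (id : Fin 3 → Fin 3) r.ρ m) (((∏ a : Fin 3, ((![(η * ((unramifiedTwist F (1 / 2) : QuasiChar F).toMonoidHom)⁻¹), (η * ((unramifiedTwist F (1 / 2) : QuasiChar F).toMonoidHom)), (η * ((unramifiedTwist F (1 / 2) : QuasiChar F).toMonoidHom)⁻¹)] : Fin 3 → (Fˣ →* ℂˣ)) a).comp (Matrix.GeneralLinearGroup.det.comp (Pi.evalMonoidHom (fun a : Fin 3 => GL {i : Fin 3 // (id : Fin 3 → Fin 3)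 i = a} F) a))) m : ℂˣ) : ℂ)) = 1 →
      (∀ ζ : (Π a : Fin 3, GL {i : Fin 3 // (id : Fin 3 → Fin 3) i = a} F) → ℂ, ζ ≠ (fun m : (Π a : Fin 3, GL {i : Fin 3 // (id : Fin 3 → Fin 3) i = a} F) => (((∏ a : Fin 3, ((![(η * ((unramifiedTwist F (1 / 2) : QuasiChar F).toMonoidHom)⁻¹), (η * ((unramifiedTwist F (1 / 2) : QuasiChar F).toMonoidHom)), (η * ((unramifiedTwist F (1 / 2) : QuasiChar F).toMonoidHom)⁻¹)] : Fin 3 → (Fˣ →* ℂˣ)) a).comp (Matrix.GeneralLinearGroup.det.comp (Pi.evalMonoidHom (fun a : Fin 3 => GL {i : Fin 3 // (id : Fin 3 → Fin 3) i = a} F) a))) m : ℂˣ) : ℂ)) → finrank ℂ ↥(⨅ m, Module.End.maxGenEigenspace (Representation.normalizedJacquetGL F (id : Fin 3 → Fin 3) r.ρ m) (ζ m)) = 0) → False := by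
  intro η hη
  have hηi : IsOpen ((η⁻¹.ker : Subgroup Fˣ) : Set Fˣ) := by rw [ker_inv_eq_ker]; exact hη
  exact noWeightAAlone_of_isIrreducible_D_low η hη
    (isIrreducible_D_low_of_isIrreducible_D_high η hη
      (isIrreducible_D_high η⁻¹ hηi (principalSeriesThreeCell F (∏ a : Fin 3, ((![(η⁻¹ * ((unramifiedTwist F (1 / 2) : QuasiChar F).toMonoidHom)⁻¹), (η⁻¹ * ((unramifiedTwist F (1 / 2) : QuasiChar F).toMonoidHom)), (η⁻¹ * ((unramifiedTwist F (1 / 2) : QuasiChar F).toMonoidHom))] : Fin 3 → (Fˣ →* ℂˣ)) a).comp (Matrix.GeneralLinearGroup.det.comp (Pi.evalMonoidHom (fun a : Fin 3 => GL {i : Fin 3 // (id : Fin 3 → Fin 3) i = a} F) a)))))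
      (principalSeriesThreeCell F (∏ a : Fin 3, ((![(η⁻¹ * ((unramifiedTwist F (1 / 2) : QuasiChar F).toMonoidHom)), (η⁻¹ * ((unramifiedTwist F (1 / 2) : QuasiChar F).toMonoidHom)⁻¹), (η⁻¹ * ((unramifiedTwist F (1 / 2) : QuasiChar F).toMonoidHom))] : Fin 3 → (Fˣ →* ℂˣ)) a).comp (Matrix.GeneralLinearGroup.det.comp (Pi.evalMonoidHom (fun a : Fin 3 => GL {i : Fin 3 // (id : Fin 3 → Fin 3) i = a} F) a)))))

/-- **NYA — «NO `Y` ALONE», UNCONDITIONALLY** (= the (C1″-NYA) socket `sig_K2E3GL3NestedHighNoWeightYAlone` body per `F`; the `hNYA` binder of ★ p861011 `sAprimeC1high_of`):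
for every `η` with open kernel, no admissible irreducible `r` of `GL₃(F)` has `E(r) = {Y(η)¹}`, `Y(η) = tch(ην½, ην½⁻¹, ην½)` — NAA transported along `θ` (★ (T)
`forall_noWeightYAlone_of_forall_noWeightAAlone`). [cite: Zelevinsky1980, §1.1, Thm. 4.2, Ex. 3.2, Thm. 6.1] [cite: BernsteinZelevinsky1977, Thm. 2.5, Thm. 2.9] -/
theorem noWeightYAlone [CharZero F] : ∀ η : Fˣ →* ℂˣ, IsOpen ((η.ker : Subgroup Fˣ) : Set Fˣ) → ∀ (r : SmoothIrrep (GL (Fin 3) F)), r.ρ.IsAdmissible → ∀ [FiniteDimensional ℂ (restrictUnipotentGL F (id : Fin 3 → Fin 3) r.ρ).Coinvariants],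
      finrank ℂ ↥(⨅ m, Module.End.maxGenEigenspace (Representation.normalizedJacquetGL F (id : Fin 3 → Fin 3) r.ρ m) (((∏ a : Fin 3, ((![(η * ((unramifiedTwist F (1 / 2) : QuasiChar F).toMonoidHom)), (η * ((unramifiedTwist F (1 / 2) : QuasiChar F).toMonoidHom)⁻¹), (η * ((unramifiedTwist F (1 / 2) : QuasiChar F).toMonoidHom))] : Fin 3 → (Fˣ →* ℂˣ)) a).comp (Matrix.GeneralLinearGroup.det.comp (Pi.evalMonoidHom (fun a : Fin 3 => GL {i : Fin 3 // (id : Fin 3 → Fin 3) i = a} F) a))) m : ℂˣ) : ℂ)) = 1 →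
      (∀ ζ : (Π a : Fin 3, GL {i : Fin 3 // (id : Fin 3 → Fin 3) i = a} F) → ℂ, ζ ≠ (fun m : (Π a : Fin 3, GL {i : Fin 3 // (id : Fin 3 → Fin 3) i = a} F) => (((∏ a : Fin 3, ((![(η * ((unramifiedTwist F (1 / 2) : QuasiChar F).toMonoidHom)), (η * ((unramifiedTwist F (1 / 2) : QuasiChar F).toMonoidHom)⁻¹), (η * ((unramifiedTwist F (1 / 2) : QuasiChar F).toMonoidHom))] : Fin 3 → (Fˣ →* ℂˣ)) a).comp (Matrix.GeneralLinearGroup.det.comp (Pi.evalMonoidHom (fun a : Fin 3 => GL {i : Fin 3 // (id : Fin 3 → Fin 3) i = a} F) a))) m : ℂˣ) : ℂ)) → finrank ℂ ↥(⨅ m, Module.End.maxGenEigenspace (Representation.normalizedJacquetGL F (id : Fin 3 → Fin 3) r.ρ m) (ζ m)) = 0) → False :=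
  forall_noWeightYAlone_of_forall_noWeightAAlone noWeightAAlone

end Summit.HodgeConjecture.HodgeConjecture.Cruxes.H413.K2E3GL3NoWeightAlone

end
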